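import Literature.NumberTheory.GaloisRepresentations.IdeleBarKSInflationAssembly
import Literature.NumberTheory.GaloisRepresentations.PresentationGaloisModulesS
import Literature.NumberTheory.GaloisRepresentations.HomDualLocalData
import HarnessLib

/-!
# The `S`-readout `R_v^S : Hom_{G_S}(N₁^S, I_S) → H¹(K_v, ρ^∨(1))` on the canonical `S`-presentation:
# definition, vanishing off `S`, (R1)_S and (R3)_S (Harari Prop. 17.26; Milne ADT I Lemma 4.13, Thm. 4.10 (a))

Topic `NumberTheory/GaloisRepresentations`; namespaces `Literature.NumberTheory.GaloisRepresentations.IdeleClassBar` (§1)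
and `…HomDual` (§2–§4).  Sequel to `IdeleBarKSInflationAssembly.lean` ((R3)_S / uniqueness for `f♯ = sharp K S f`),
-w7 g11's `PresentationGaloisModulesS.lean` (`presentationComplexS ρ S`, `inflPresentationSIso₁ ρ S hur : Inf (N₁^S) ≅ N₁`)
and door-c6's `HomDualLocalData.lean` (`readout_eq_localReadout`, `localReadout_surjective`).  Plumbing definitions with
bodies (`presSharp`, `presSharpHom`, **`readoutS`**) and theorems; NO named fact, no `sorry`, no instance, no notation;
number fields in `Type`.

THE MATHEMATICS (Milne I, proof of Thm. 4.10 (a) for `G_S`, p. 58; Harari Prop. 17.26).  `K` a number field,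
`S` a finite set of finite places, `ρ` a finite discrete `Γ_K`-module on `M` killed by `n` and UNRAMIFIED OUTSIDE `S`
(`hur : N_S ≤ ker ρ`), `0 → N₁ → P → M → 0` its canonical presentation in `C_Γ` (`presentationComplex ρ`) and
`0 → N₁^S → P^S → M → 0` the `S`-presentation in `C_{G_S}` (`presentationComplexS ρ S`, its `N_S`-invariants), with
`e₁ : Inf (N₁^S) ≅ N₁`.  A `G_S`-morphism `f : N₁^S ⟶ I_S` into Harari's truncated idèles is read on `Γ_K` as
`presSharp f := e₁⁻¹ ≫ f♯ : N₁ ⟶ J̄`, and door-c6's idèle readout gives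
**`readoutS ρ n hM S hur v f := readout ρ n hM (π_v) (e₁⁻¹ ≫ f♯) ∈ H¹(K_v, ρ^∨(1))`** — the datum `R v` of the
lane's readout skeleton (`ShaReadout.pairing`, `EJ := Hom_{G_S}(N₁^S, I_S)`).
* §1 (transport, any `Y ≅ Inf X`): (R3)_S and uniqueness of `IdeleBarKSInflationAssembly` read through an
  isomorphism `e : Y ≅ Inf X` of `C_Γ` (`exists_hom_readoutInvariant_iso_sharp_eq`,
  `hom_ext_of_readoutInvariant_iso_sharp_eq`) — the layer trivialising `Y` need not lie inside `K_S`.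
* §2 `presSharp`, `presSharpHom` (additive, injective), `presSharp_eq_inflHomX₁_comp` (= -w7's reader `inflHomX₁ ≫ ι_S`),
  `readoutS`, `readoutS_eq_localReadout`, **`readoutS_inr_eq_zero_of_not_mem`** (`R_v^S = 0` at finite `v ∉ S`).
* §3 **(R1)_S** `readoutS_f_comp`: `R_v^S (f^S ≫ q) = 0` for `q : P^S ⟶ I_S` (naturality square of `e₁, e₂` + door-c6 (R1)).
* §4 **(R3)_S at the level of classes** `exists_readoutS_eq` / `exists_forall_mem_readoutS_eq`: every family
  `(t_v)_v`, `t_v ∈ H¹(K_v, ρ^∨(1))`, is `(R_v^S f)_{v ∈ S ∪ ∞}` for ONE `f : N₁^S ⟶ I_S` (door-c6's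
  `localReadout_surjective` at `v ∈ S ∪ ∞`, zero data off `S`, then §1) — VERBATIM the hypothesis `hR3` of
  `ShaReadout.pairing_perfect` for `R v := readoutS ρ n hM S hur v` and `Sig = S ∪ Ω_∞`.

Written for lane «PT-Ш-S-TC» (brick D4b: `R_v`, (R1)_S, (R3)_S) of crux `GoodLatticeBDPValue` (cell bsd-eis, item 19032),
seat bsd-line-x1-p1-w6 gen 11.  HONEST FRAMING: bookkeeping; no case of Poitou–Tate duality or BSD is proved here;
(R2)_S (principal `S`-units) and (R4)_S (the pairing dictionary with `inv_S`) are not addressed in this file.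

## References
* J. S. Milne, *Arithmetic Duality Theorems*, 2nd ed. (2006), I Lemma 4.13 (proof), I Thm. 4.10 (a) (proof, p. 58). [MilneADT2006]
* D. Harari, *Galois Cohomology and Class Field Theory* (2020), §17.4 (17.1), Prop. 17.26 (proof), §4.3 Rem. 4.24. [Harari2020]
* J. W. S. Cassels, A. Fröhlich (eds.), *Algebraic Number Theory* (1967), Ch. VII (J. Tate) §8 Prop. 8.1. [CasselsFrohlichANT1967]
-/

noncomputable section

open NumberField NumberField.InfinitePlace IsDedekindDomain CategoryTheory
open Field (absoluteGaloisGroup)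
open Literature.NumberTheory.Automorphic Literature.Algebra.Homology Literature.Algebra.Homology.DiscreteRep
open scoped Classical

namespace Literature.NumberTheory.GaloisRepresentations

/-! ## §1. Transport along an isomorphism `e : Y ≅ Inf X` of `C_Γ` -/

namespace IdeleClassBar

open IdeleReadout HomDual DGMBridge DiscreteGaloisModule

variable {K : Type} [Field K] [NumberField K] {S : Finset (HeightOneSpectrum (𝓞 K))}
variable {X : DiscreteRepCat ℤ (GaloisGroupUnramifiedOutside K (↑S : Set (HeightOneSpectrum (𝓞 K))))}
variable {Y : DiscreteRepCat ℤ (absoluteGaloisGroup K)}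

/-- Vectors: `(u ≫ f♯) y = (f (u y) : J̄)`. [cite: Harari2020, Prop. 17.26 (proof)] -/
theorem comp_sharp_hom_apply (u : Y ⟶ (inflKS K S).obj X) (f : X ⟶ truncIdeleBarD K S) (y : Y.obj.V) :
    (u ≫ sharp K S f).hom.hom y = Subtype.val (f.hom.hom (u.hom.hom y)) := by
  change (sharp K S f).hom.hom (u.hom.hom y) = _
  rw [sharp_hom_apply]

/-- `π_v ∘ (u ≫ f♯) = 0` at a finite `v ∉ S`. [cite: Harari2020, Lemma 15.39, Prop. 17.26 (proof)] -/
theorem finIdelePi_comp_sharp_of_not_mem (u : Y ⟶ (inflKS K S).obj X) (f : X ⟶ truncIdeleBarD K S)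
    {v : HeightOneSpectrum (𝓞 K)} (hv : v ∉ S) (y : Y.obj.V) :
    finIdelePi v ((u ≫ sharp K S f).hom.hom y) = 0 := by
  change finIdelePi v ((sharp K S f).hom.hom (u.hom.hom y)) = 0
  exact finIdelePi_sharp_of_not_mem f hv _

/-- Vectors: `(e ≫ (truncSharp (e⁻¹ ≫ f₀))♯) y = trunc (f₀ y)`. [cite: Harari2020, §17.4 (17.1), Prop. 17.26 (proof)] -/
theorem iso_hom_comp_sharp_truncSharp_hom_apply (e : Y ≅ (inflKS K S).obj X) (f₀ : Y ⟶ ideleBarD K) (y : Y.obj.V) :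
    (e.hom ≫ sharp K S (truncSharp (e.inv ≫ f₀))).hom.hom y = truncBar K S (f₀.hom.hom y) := by
  change (sharp K S (truncSharp (e.inv ≫ f₀))).hom.hom (e.hom.hom.hom y) = _
  rw [sharp_truncSharp_hom_apply]
  change truncBar K S ((e.hom ≫ e.inv ≫ f₀).hom.hom y) = _
  rw [Iso.hom_inv_id_assoc]

variable [Module.Finite ℤ (LCarrier Y)]

/-- Readout invariant of `u ≫ f♯` at a finite `v ∉ S` is `0`. [cite: Harari2020, Lemma 15.39, Prop. 17.26] -/
theorem readoutInvariant_comp_sharp_inr_of_not_mem (u : Y ⟶ (inflKS K S).obj X) (f : X ⟶ truncIdeleBarD K S)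
    {v : HeightOneSpectrum (𝓞 K)} (hv : v ∉ S) :
    readoutInvariant (ideleProjection K (Sum.inr v)) Y (u ≫ sharp K S f) = 0 := by
  refine Subtype.ext (LinearMap.ext fun y => ?_)
  rw [coe_readoutInvariant, readoutMap_apply, ideleProjection_inr_toAddMonoidHom]
  exact finIdelePi_comp_sharp_of_not_mem u f hv _

/-- Readout invariant of `e ≫ (truncSharp (e⁻¹ ≫ f₀))♯` at a finite `v ∈ S` = that of `f₀`. [cite: Harari2020, Prop. 17.26 (proof)] -/
theorem readoutInvariant_iso_sharp_truncSharp_inr_of_mem (e : Y ≅ (inflKS K S).obj X) (f₀ : Y ⟶ ideleBarD K)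
    {v : HeightOneSpectrum (𝓞 K)} (hv : v ∈ S) :
    readoutInvariant (ideleProjection K (Sum.inr v)) Y (e.hom ≫ sharp K S (truncSharp (e.inv ≫ f₀))) =
      readoutInvariant (ideleProjection K (Sum.inr v)) Y f₀ := by
  refine Subtype.ext (LinearMap.ext fun y => ?_)
  rw [coe_readoutInvariant, coe_readoutInvariant, readoutMap_apply, readoutMap_apply,
    iso_hom_comp_sharp_truncSharp_hom_apply, ideleProjection_inr_toAddMonoidHom]
  exact finIdelePi_truncBar_of_mem K S hv _

/-- Readout invariant of `e ≫ (truncSharp (e⁻¹ ≫ f₀))♯` at a finite `v ∉ S` is `0`. [cite: Harari2020, Lemma 15.39] -/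
theorem readoutInvariant_iso_sharp_truncSharp_inr_of_not_mem (e : Y ≅ (inflKS K S).obj X) (f₀ : Y ⟶ ideleBarD K)
    {v : HeightOneSpectrum (𝓞 K)} (hv : v ∉ S) :
    readoutInvariant (ideleProjection K (Sum.inr v)) Y (e.hom ≫ sharp K S (truncSharp (e.inv ≫ f₀))) = 0 :=
  readoutInvariant_comp_sharp_inr_of_not_mem e.hom _ hv

/-- Readout invariant of `e ≫ (truncSharp (e⁻¹ ≫ f₀))♯` at an infinite place = that of `f₀`. [cite: Harari2020, Prop. 17.26 (proof)] -/
theorem readoutInvariant_iso_sharp_truncSharp_inl (e : Y ≅ (inflKS K S).obj X) (f₀ : Y ⟶ ideleBarD K)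
    (w : InfinitePlace K) :
    readoutInvariant (ideleProjection K (Sum.inl w)) Y (e.hom ≫ sharp K S (truncSharp (e.inv ≫ f₀))) =
      readoutInvariant (ideleProjection K (Sum.inl w)) Y f₀ := by
  refine Subtype.ext (LinearMap.ext fun y => ?_)
  rw [coe_readoutInvariant, coe_readoutInvariant, readoutMap_apply, readoutMap_apply,
    iso_hom_comp_sharp_truncSharp_hom_apply, ideleProjection_inl_toAddMonoidHom]
  exact archIdelePi_truncBar K S w _

/-- **(R3)_S through an isomorphism `e : Y ≅ Inf X`**: for `Y ∈ C_Γ` of finite type trivialised by a layer `E` and a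
family of invariants `h_v ∈ Hom_ℤ(Y|_v, K̄_vˣ)^{Γ_{K_v}}` vanishing at the finite `v ∉ S`, there is `f : X ⟶ I_S` with
`readoutInvariant π_v Y (e ≫ f♯) = h_v` at every place. [cite: Harari2020, Prop. 17.26 (proof)]
[cite: MilneADT2006, I Lemma 4.13 (proof)] [cite: CasselsFrohlichANT1967, Ch. VII §8 Prop. 8.1] -/
theorem exists_hom_readoutInvariant_iso_sharp_eq (e : Y ≅ (inflKS K S).obj X) (E : GalLayer K)
    (hY : ∀ σ ∈ E.openNormalSubgroup, ∀ y : Y.obj.V, Y.obj.ρ σ y = y)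
    (h : ∀ v : Place K,
      (homGaloisModule ((toDGM Y).restrictField (Place.Completion v)) (units (Place.Completion v))).toTopRep.ρ.invariants)
    (hzero : ∀ v : HeightOneSpectrum (𝓞 K), v ∉ S → h (Sum.inr v) = 0) :
    ∃ f : X ⟶ truncIdeleBarD K S, ∀ v : Place K,
      readoutInvariant (ideleProjection K v) Y (e.hom ≫ sharp K S f) = h v := by
  classical
  have hunit : ∀ v : HeightOneSpectrum (𝓞 K), (Sum.inr v : Place K) ∉ S.map ⟨Sum.inr, Sum.inr_injective⟩ →
      ∀ y : LCarrier Y, IsNonarchimedeanLocalField.ordQ (v.adicCompletion K)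
        ((show LCarrier Y →ₗ[ℤ] UnitsCarrier (v.adicCompletion K) from
          ((h (Sum.inr v)).1 : DiscreteRep.HomCarrier (LCarrier Y) (UnitsCarrier (v.adicCompletion K)))) y) = 0 := by
    intro v hv y
    have hv' : v ∉ S := fun hvS => hv (Finset.mem_map.2 ⟨v, hvS, rfl⟩)
    rw [hzero v hv']
    exact map_zero _
  obtain ⟨f₀, hf₀⟩ := exists_hom_readoutInvariant_eq Y E hY (S.map ⟨Sum.inr, Sum.inr_injective⟩) h hunit
  refine ⟨truncSharp (e.inv ≫ f₀), fun v => ?_⟩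
  rcases v with w | v
  · rw [readoutInvariant_iso_sharp_truncSharp_inl, hf₀]
  · by_cases hv : v ∈ S
    · rw [readoutInvariant_iso_sharp_truncSharp_inr_of_mem e f₀ hv, hf₀]
    · rw [readoutInvariant_iso_sharp_truncSharp_inr_of_not_mem e f₀ hv, hzero v hv]

/-- **Uniqueness through an isomorphism `e : Y ≅ Inf X`**: `f = g` as soon as the readout invariants of `e ≫ f♯` and
`e ≫ g♯` agree at `v ∈ S` and at the infinite places. [cite: Harari2020, Prop. 17.26 (proof)] [cite: MilneADT2006, I Lemma 4.13 (proof)] -/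
theorem hom_ext_of_readoutInvariant_iso_sharp_eq (e : Y ≅ (inflKS K S).obj X) (E : GalLayer K)
    (hY : ∀ σ ∈ E.openNormalSubgroup, ∀ y : Y.obj.V, Y.obj.ρ σ y = y) {f g : X ⟶ truncIdeleBarD K S}
    (hfin : ∀ v ∈ S, readoutInvariant (ideleProjection K (Sum.inr v)) Y (e.hom ≫ sharp K S f) =
      readoutInvariant (ideleProjection K (Sum.inr v)) Y (e.hom ≫ sharp K S g))
    (hinf : ∀ w : InfinitePlace K, readoutInvariant (ideleProjection K (Sum.inl w)) Y (e.hom ≫ sharp K S f) =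
      readoutInvariant (ideleProjection K (Sum.inl w)) Y (e.hom ≫ sharp K S g)) :
    f = g := by
  apply sharp_injective
  rw [← cancel_epi e.hom]
  refine hom_ext_of_readoutInvariant_eq E hY fun v => ?_
  rcases v with w | v
  · exact hinf w
  · by_cases hv : v ∈ S
    · exact hfin v hv
    · rw [readoutInvariant_comp_sharp_inr_of_not_mem e.hom f hv, readoutInvariant_comp_sharp_inr_of_not_mem e.hom g hv]

/-- All-places form of the uniqueness through `e`. [cite: MilneADT2006, I Lemma 4.13 (proof)] -/
theorem hom_ext_of_forall_readoutInvariant_iso_sharp_eq (e : Y ≅ (inflKS K S).obj X) (E : GalLayer K)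
    (hY : ∀ σ ∈ E.openNormalSubgroup, ∀ y : Y.obj.V, Y.obj.ρ σ y = y) {f g : X ⟶ truncIdeleBarD K S}
    (h : ∀ v : Place K, readoutInvariant (ideleProjection K v) Y (e.hom ≫ sharp K S f) =
      readoutInvariant (ideleProjection K v) Y (e.hom ≫ sharp K S g)) :
    f = g :=
  hom_ext_of_readoutInvariant_iso_sharp_eq e E hY (fun v _ => h (Sum.inr v)) (fun w => h (Sum.inl w))

end IdeleClassBar

/-! ## §2. The `S`-readout on the canonical `S`-presentation -/

namespace HomDual

open IdeleClassBar IdeleReadout FreePresentation DGMBridge DiscreteGaloisModule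

variable {K : Type} [Field K] [NumberField K]
variable {M : Type} [AddCommGroup M] [TopologicalSpace M] [DiscreteTopology M] [Finite M]
variable (ρ : DiscreteGaloisModule K M) (n : ℕ) [NeZero n]
variable (S : Finset (HeightOneSpectrum (𝓞 K)))
  (hur : ramificationSubgroup K (↑S : Set (HeightOneSpectrum (𝓞 K))) ≤ ContinuousRep.ker ρ)

/-- **`f ↦ e₁⁻¹ ≫ f♯ : Hom_{G_S}(N₁^S, I_S) → Hom_{Γ_K}(N₁, J̄)`** — a `G_S`-morphism out of the `S`-presentation kernel
read on `Γ_K` (`e₁ = inflPresentationSIso₁`). [cite: MilneADT2006, I Thm. 4.10 (a) (proof, p. 58)] [cite: Harari2020, Prop. 17.26 (proof)] -/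
def presSharp (f : (presentationComplexS ρ (↑S : Set (HeightOneSpectrum (𝓞 K)))).X₁ ⟶ truncIdeleBarD K S) :
    (presentationComplex ρ).X₁ ⟶ ideleBarD K :=
  (inflPresentationSIso₁ ρ (↑S : Set (HeightOneSpectrum (𝓞 K))) hur).inv ≫ sharp K S f

/-- Unfolding. [cite: Harari2020, Prop. 17.26 (proof)] -/
theorem presSharp_eq (f : (presentationComplexS ρ (↑S : Set (HeightOneSpectrum (𝓞 K)))).X₁ ⟶ truncIdeleBarD K S) :
    presSharp ρ S hur f = (inflPresentationSIso₁ ρ (↑S : Set (HeightOneSpectrum (𝓞 K))) hur).inv ≫ sharp K S f := rfl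

/-- Spelling `(e₁.symm).hom ≫ f♯` (§1). [cite: Harari2020, Prop. 17.26 (proof)] -/
theorem presSharp_eq_symm_hom_comp (f : (presentationComplexS ρ (↑S : Set (HeightOneSpectrum (𝓞 K)))).X₁ ⟶ truncIdeleBarD K S) :
    presSharp ρ S hur f = (inflPresentationSIso₁ ρ (↑S : Set (HeightOneSpectrum (𝓞 K))) hur).symm.hom ≫ sharp K S f := rfl

/-- **`presSharp f = inflHomX₁ f ≫ ι_S`** (-w7 g11's reader followed by the inflated inclusion `ι_S = (𝟙 I_S)♯`).
[cite: MilneADT2006, I §4 (proof of Thm. 4.10, p. 58)] -/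
theorem presSharp_eq_inflHomX₁_comp (f : (presentationComplexS ρ (↑S : Set (HeightOneSpectrum (𝓞 K)))).X₁ ⟶ truncIdeleBarD K S) :
    presSharp ρ S hur f = inflHomX₁ ρ (↑S : Set (HeightOneSpectrum (𝓞 K))) hur f ≫ sharp K S (𝟙 (truncIdeleBarD K S)) := by
  rw [presSharp_eq, sharp_eq_map_comp_sharp_id f, inflHomX₁, Category.assoc]

/-- `presSharp (f + g) = presSharp f + presSharp g`. [cite: Harari2020, Prop. 17.26 (proof)] -/
theorem presSharp_add (f g : (presentationComplexS ρ (↑S : Set (HeightOneSpectrum (𝓞 K)))).X₁ ⟶ truncIdeleBarD K S) :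
    presSharp ρ S hur (f + g) = presSharp ρ S hur f + presSharp ρ S hur g := by
  rw [presSharp_eq, presSharp_eq, presSharp_eq, sharp_add, Preadditive.comp_add]

/-- `presSharp 0 = 0`. [cite: Harari2020, Prop. 17.26 (proof)] -/
theorem presSharp_zero :
    presSharp ρ S hur (0 : (presentationComplexS ρ (↑S : Set (HeightOneSpectrum (𝓞 K)))).X₁ ⟶ truncIdeleBarD K S) = 0 := by
  rw [presSharp_eq, sharp_zero, Limits.comp_zero]

/-- **`presSharp` is injective** (`e₁⁻¹` is an isomorphism, `♯` is injective). [cite: Harari2020, Prop. 17.26 (proof)] -/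
theorem presSharp_injective : Function.Injective (presSharp ρ S hur) := fun f g h => by
  rw [presSharp_eq, presSharp_eq, cancel_epi] at h
  exact sharp_injective h

/-- `presSharp` as an additive map. [cite: Harari2020, Prop. 17.26 (proof)] -/
def presSharpHom : ((presentationComplexS ρ (↑S : Set (HeightOneSpectrum (𝓞 K)))).X₁ ⟶ truncIdeleBarD K S) →+
    ((presentationComplex ρ).X₁ ⟶ ideleBarD K) where
  toFun := presSharp ρ S hur
  map_zero' := presSharp_zero ρ S hur
  map_add' := presSharp_add ρ S hur

/-- Unfolding. [cite: Harari2020, Prop. 17.26 (proof)] -/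
@[simp] theorem presSharpHom_apply (f : (presentationComplexS ρ (↑S : Set (HeightOneSpectrum (𝓞 K)))).X₁ ⟶ truncIdeleBarD K S) :
    presSharpHom ρ S hur f = presSharp ρ S hur f := rfl

/-- **The `S`-readout `R_v^S : Hom_{G_S}(N₁^S, I_S) →+ H¹(K_v, ρ^∨(1))`**, `f ↦ readout_v (e₁⁻¹ ≫ f♯)` — door-c6's idèle
readout of the `Γ_K`-reading of `f` (every place `v`; it vanishes at the finite `v ∉ S`).  This is the datum `R v` of the
lane's readout skeleton with `EJ := Hom_{G_S}(N₁^S, I_S)`. [cite: MilneADT2006, I Thm. 4.10 (a) (proof, p. 58), Lemma 4.13]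
[cite: Harari2020, Prop. 17.26] -/
def readoutS (hM : ∀ m : M, n • m = 0) (v : Place K) :
    ((presentationComplexS ρ (↑S : Set (HeightOneSpectrum (𝓞 K)))).X₁ ⟶ truncIdeleBarD K S) →+
      galoisCohomology ((ρ.tateDual n).toLocal v) 1 :=
  (readout ρ n hM (ideleProjection K v)).comp (presSharpHom ρ S hur)

/-- Unfolding: `R_v^S f = readout_v (presSharp f)`. [cite: MilneADT2006, I Lemma 4.13 (proof)] -/
theorem readoutS_apply (hM : ∀ m : M, n • m = 0) (v : Place K)
    (f : (presentationComplexS ρ (↑S : Set (HeightOneSpectrum (𝓞 K)))).X₁ ⟶ truncIdeleBarD K S) :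
    readoutS ρ n S hur hM v f = readout ρ n hM (ideleProjection K v) (presSharp ρ S hur f) := rfl

/-- **`R_v^S f = localReadout (π_v ∘ presSharp f)`.** [cite: MilneADT2006, I Lemma 4.13 (proof)] -/
theorem readoutS_eq_localReadout (hM : ∀ m : M, n • m = 0) (v : Place K)
    (f : (presentationComplexS ρ (↑S : Set (HeightOneSpectrum (𝓞 K)))).X₁ ⟶ truncIdeleBarD K S) :
    readoutS ρ n S hur hM v f =
      (haveI : CharZero (Place.Completion v) := charZero_of_algebra (K := K) (Place.Completion v)
       haveI := moduleFinite_presModule₁ ρ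
       localReadout ρ n hM (Place.Completion v)
        (readoutInvariant (ideleProjection K v) (presentationComplex ρ).X₁ (presSharp ρ S hur f))) := rfl

/-- **The readout invariant of `presSharp f` vanishes at a finite `v ∉ S`.** [cite: Harari2020, Lemma 15.39, Prop. 17.26] -/
theorem readoutInvariant_presSharp_inr_of_not_mem {v : HeightOneSpectrum (𝓞 K)} (hv : v ∉ S)
    (f : (presentationComplexS ρ (↑S : Set (HeightOneSpectrum (𝓞 K)))).X₁ ⟶ truncIdeleBarD K S) :
    (haveI := moduleFinite_presModule₁ ρ
     readoutInvariant (ideleProjection K (Sum.inr v)) (presentationComplex ρ).X₁ (presSharp ρ S hur f)) = 0 := by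
  haveI := moduleFinite_presModule₁ ρ
  exact readoutInvariant_comp_sharp_inr_of_not_mem _ f hv

/-- The local readout of the zero invariant is zero. [cite: MilneADT2006, I Lemma 4.13 (proof)] -/
theorem localReadout_zero (hM : ∀ m : M, n • m = 0) (K' : Type) [Field K'] [Algebra K K'] [CharZero K'] :
    localReadout ρ n hM K' 0 = 0 := by
  haveI := moduleFinite_presModule₁ ρ
  haveI := moduleFinite_presModule₂ ρ
  unfold localReadout
  rw [map_zero]
  exact map_zero _

/-- **`R_v^S = 0` at a finite place `v ∉ S`** (only the places of `S ∪ ∞` are read: `P¹_S`).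
[cite: Harari2020, Lemma 15.39, Prop. 17.26] [cite: MilneADT2006, I §4 (definition of `P^r_S`)] -/
theorem readoutS_inr_eq_zero_of_not_mem (hM : ∀ m : M, n • m = 0) {v : HeightOneSpectrum (𝓞 K)} (hv : v ∉ S)
    (f : (presentationComplexS ρ (↑S : Set (HeightOneSpectrum (𝓞 K)))).X₁ ⟶ truncIdeleBarD K S) :
    readoutS ρ n S hur hM (Sum.inr v) f = 0 := by
  haveI : CharZero (Place.Completion (Sum.inr v : Place K)) :=
    charZero_of_algebra (K := K) (Place.Completion (Sum.inr v : Place K))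
  rw [readoutS_eq_localReadout, readoutInvariant_presSharp_inr_of_not_mem ρ S hur hv f]
  exact localReadout_zero ρ n hM _

/-! ## §3. (R1)_S: the readout of a morphism extending to `P^S` vanishes -/

/-- `e₁⁻¹ ≫ Inf(f^S) = f ≫ e₂⁻¹` (the naturality square of the counit isomorphisms, inverted).
[cite: Harari2020, §4.3 Remark 4.24] -/
theorem inflPresentationSIso₁_inv_comp_map_f :
    (inflPresentationSIso₁ ρ (↑S : Set (HeightOneSpectrum (𝓞 K))) hur).inv ≫
        (inflKS K S).map (presentationComplexS ρ (↑S : Set (HeightOneSpectrum (𝓞 K)))).f =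
      (presentationComplex ρ).f ≫ (inflPresentationSIso₂ ρ (↑S : Set (HeightOneSpectrum (𝓞 K))) hur).inv := by
  rw [Iso.inv_comp_eq, ← Category.assoc, Iso.eq_comp_inv]
  exact inflQuotFunctor_map_presentationComplexS_f ρ (↑S : Set (HeightOneSpectrum (𝓞 K))) hur

/-- **`presSharp (f^S ≫ q) = f ≫ (e₂⁻¹ ≫ q♯)`**: a morphism extending to `P^S` is read as one extending to `P`.
[cite: MilneADT2006, I Lemma 4.13 (proof)] -/
theorem presSharp_f_comp (q : (presentationComplexS ρ (↑S : Set (HeightOneSpectrum (𝓞 K)))).X₂ ⟶ truncIdeleBarD K S) :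
    presSharp ρ S hur ((presentationComplexS ρ (↑S : Set (HeightOneSpectrum (𝓞 K)))).f ≫ q) =
      (presentationComplex ρ).f ≫
        ((inflPresentationSIso₂ ρ (↑S : Set (HeightOneSpectrum (𝓞 K))) hur).inv ≫ sharp K S q) := by
  rw [presSharp_eq, sharp_comp, ← Category.assoc, inflPresentationSIso₁_inv_comp_map_f, Category.assoc]

/-- **(R1)_S**: `R_v^S (f^S ≫ q) = 0` for every `q : P^S ⟶ I_S` (door-c6's (R1) `readout_f_comp` after the square).
This is the `S`-copy of hypothesis `hR1` of the presentation road. [cite: MilneADT2006, I Lemma 4.13 (proof), Thm. 4.10 (proof, p. 58)] -/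
theorem readoutS_f_comp (hM : ∀ m : M, n • m = 0) (v : Place K)
    (q : (presentationComplexS ρ (↑S : Set (HeightOneSpectrum (𝓞 K)))).X₂ ⟶ truncIdeleBarD K S) :
    readoutS ρ n S hur hM v ((presentationComplexS ρ (↑S : Set (HeightOneSpectrum (𝓞 K)))).f ≫ q) = 0 := by
  rw [readoutS_apply, presSharp_f_comp]
  exact readout_f_comp ρ n hM (ideleProjection K v) _

/-! ## §4. (R3)_S at the level of classes: every local family on `S ∪ ∞` is a readout -/

/-- **(R3)_S for classes** (Milne I Lemma 4.13 / Harari Prop. 17.26, surjectivity of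
`Hom_{G_S}(N₁^S, I_S) → ∏_{v ∈ S ∪ ∞} H¹(K_v, ρ^∨(1))`): every family `(t_v)_v` of local classes is `(R_v^S f)_v`
at the places of `S` and at the infinite places, for ONE `f : N₁^S ⟶ I_S` (each `t_v` is a local readout by door-c6's
`localReadout_surjective`; zero data at the finite `v ∉ S`; assembled by `exists_hom_readoutInvariant_iso_sharp_eq`).
[cite: MilneADT2006, I Lemma 4.13 (proof), Thm. 4.10 (a) (proof, p. 58)] [cite: Harari2020, Prop. 17.26] -/
theorem exists_readoutS_eq (hM : ∀ m : M, n • m = 0) (t : Π v : Place K, galoisCohomology ((ρ.tateDual n).toLocal v) 1) :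
    ∃ f : (presentationComplexS ρ (↑S : Set (HeightOneSpectrum (𝓞 K)))).X₁ ⟶ truncIdeleBarD K S,
      (∀ v ∈ S, readoutS ρ n S hur hM (Sum.inr v) f = t (Sum.inr v)) ∧
      (∀ w : InfinitePlace K, readoutS ρ n S hur hM (Sum.inl w) f = t (Sum.inl w)) := by
  classical
  haveI := moduleFinite_presModule₁ ρ
  have hfin : ∀ v : HeightOneSpectrum (𝓞 K),
      ∃ hv : (homGaloisModule ((presModule₁ ρ).restrictField (Place.Completion (Sum.inr v : Place K)))
          (DiscreteGaloisModule.units (Place.Completion (Sum.inr v : Place K)))).toTopRep.ρ.invariants,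
        (v ∈ S → (haveI : CharZero (Place.Completion (Sum.inr v : Place K)) :=
            charZero_of_algebra (K := K) (Place.Completion (Sum.inr v : Place K));
          localReadout ρ n hM (Place.Completion (Sum.inr v : Place K)) hv) = t (Sum.inr v)) ∧
        (v ∉ S → hv = 0) := by
    intro v
    haveI : CharZero (Place.Completion (Sum.inr v : Place K)) :=
      charZero_of_algebra (K := K) (Place.Completion (Sum.inr v : Place K))
    by_cases hvS : v ∈ S
    · obtain ⟨h, hh⟩ := localReadout_surjective ρ n hM (Place.Completion (Sum.inr v : Place K)) (t (Sum.inr v))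
      exact ⟨h, fun _ => hh, fun h' => (h' hvS).elim⟩
    · exact ⟨0, fun h' => (hvS h').elim, fun _ => rfl⟩
  have hinf : ∀ w : InfinitePlace K,
      ∃ hv : (homGaloisModule ((presModule₁ ρ).restrictField (Place.Completion (Sum.inl w : Place K)))
          (DiscreteGaloisModule.units (Place.Completion (Sum.inl w : Place K)))).toTopRep.ρ.invariants,
        (haveI : CharZero (Place.Completion (Sum.inl w : Place K)) :=
            charZero_of_algebra (K := K) (Place.Completion (Sum.inl w : Place K));
          localReadout ρ n hM (Place.Completion (Sum.inl w : Place K)) hv) = t (Sum.inl w) := by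
    intro w
    haveI : CharZero (Place.Completion (Sum.inl w : Place K)) :=
      charZero_of_algebra (K := K) (Place.Completion (Sum.inl w : Place K))
    exact localReadout_surjective ρ n hM (Place.Completion (Sum.inl w : Place K)) (t (Sum.inl w))
  choose hf hhf hzf using hfin
  choose hi hhi using hinf
  obtain ⟨f, hf⟩ := exists_hom_readoutInvariant_iso_sharp_eq
    (X := (presentationComplexS ρ (↑S : Set (HeightOneSpectrum (𝓞 K)))).X₁)
    (inflPresentationSIso₁ ρ (↑S : Set (HeightOneSpectrum (𝓞 K))) hur).symm (presentationLayer ρ)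
    (presentationComplex_X₁_trivial ρ)
    (fun v => Sum.rec (motive := fun v : Place K =>
      (homGaloisModule ((presModule₁ ρ).restrictField (Place.Completion v))
        (DiscreteGaloisModule.units (Place.Completion v))).toTopRep.ρ.invariants) hi hf v)
    (fun v hv => hzf v hv)
  refine ⟨f, fun v hv => ?_, fun w => ?_⟩
  · rw [readoutS_eq_localReadout, presSharp_eq_symm_hom_comp, hf (Sum.inr v)]
    exact hhf v hv
  · rw [readoutS_eq_localReadout, presSharp_eq_symm_hom_comp, hf (Sum.inl w)]
    exact hhi w

/-- **(R3)_S in the shape of the readout skeleton's `hR3`** (`Sig = S ∪ Ω_∞`): `∀ t, ∃ f, ∀ v ∈ Sig, R_v^S f = t_v`.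
[cite: MilneADT2006, I Thm. 4.10 (a) (proof, p. 58), Lemma 4.13] -/
theorem exists_forall_mem_readoutS_eq (hM : ∀ m : M, n • m = 0) (Sig : Finset (Place K))
    (hSig₂ : ∀ v : HeightOneSpectrum (𝓞 K), (Sum.inr v : Place K) ∈ Sig ↔ v ∈ S)
    (t : Π v : Place K, galoisCohomology ((ρ.tateDual n).toLocal v) 1) :
    ∃ f : (presentationComplexS ρ (↑S : Set (HeightOneSpectrum (𝓞 K)))).X₁ ⟶ truncIdeleBarD K S,
      ∀ v ∈ Sig, readoutS ρ n S hur hM v f = t v := by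
  obtain ⟨f, hfin, hinf⟩ := exists_readoutS_eq ρ n S hur hM t
  refine ⟨f, fun v hv => ?_⟩
  rcases v with w | v
  · exact hinf w
  · exact hfin v ((hSig₂ v).1 hv)

/-- **Hom-level uniqueness on the `S`-presentation**: `f = g` if the readout invariants of `presSharp f`, `presSharp g`
agree at `v ∈ S` and at the infinite places. [cite: MilneADT2006, I Lemma 4.13 (proof)] -/
theorem hom_ext_of_readoutInvariant_presSharp_eq {f g : (presentationComplexS ρ (↑S : Set (HeightOneSpectrum (𝓞 K)))).X₁ ⟶ truncIdeleBarD K S}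
    (hfin : ∀ v ∈ S, (haveI := moduleFinite_presModule₁ ρ
      readoutInvariant (ideleProjection K (Sum.inr v)) (presentationComplex ρ).X₁ (presSharp ρ S hur f)) =
      (haveI := moduleFinite_presModule₁ ρ
       readoutInvariant (ideleProjection K (Sum.inr v)) (presentationComplex ρ).X₁ (presSharp ρ S hur g)))
    (hinf : ∀ w : InfinitePlace K, (haveI := moduleFinite_presModule₁ ρ
      readoutInvariant (ideleProjection K (Sum.inl w)) (presentationComplex ρ).X₁ (presSharp ρ S hur f)) =
      (haveI := moduleFinite_presModule₁ ρ
       readoutInvariant (ideleProjection K (Sum.inl w)) (presentationComplex ρ).X₁ (presSharp ρ S hur g))) :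
    f = g := by
  haveI := moduleFinite_presModule₁ ρ
  exact hom_ext_of_readoutInvariant_iso_sharp_eq
    (inflPresentationSIso₁ ρ (↑S : Set (HeightOneSpectrum (𝓞 K))) hur).symm (presentationLayer ρ)
    (presentationComplex_X₁_trivial ρ) hfin hinf

end HomDual

end Literature.NumberTheory.GaloisRepresentations

end
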